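import Literature.MathematicalPhysics.QuantumFieldTheory.Balaban1983to89.B6Prop26KLevelSkeletonV2
import Literature.MathematicalPhysics.QuantumFieldTheory.Balaban1983to89.B6InMajorantTransplant

/-!
# `Balaban1983to89.B6Prop26LeftEntryKLevelV1` — T. Bałaban, *Propagators and renormalization transformations for lattice gauge theories. II*,
# Commun. Math. Phys. **96** (1984) 223–250 [Balaban1984PropagatorsII], Prop. 2.6 p. 247, THE ENTRIES OF (2.136) WITH A LEFT FACTOR
# (`|(∇GJ)(x)|`, `|(ΔGJ)(x)|`) FOR THE GENUINE `k`-LEVEL `G = Δ_a⁻¹` ON THE V1 TORUS — THE GLUING AND THE k-LEVEL «PAIR» SKELETON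

statement-level skeleton of published theorems with citation tags; proofs where landed; nothing here is a claim about the Yang–Mills mass gap

PDF held: `paper:balaban1984-cmp96-propagators-rt-ii` (journal page = PDF page + 222), p. 247 [PDF 25] re-read this generation on the text layer
(`p0025.txt`): *"Reasoning in the same way as in the proof of Proposition 2.2 we obtain Proposition 2.6. There exists a positive constant δ₃ depending
on d and L only, such that |(GJ)(x)|, |(∇GJ)(x)|, |(G∇*J)(x)|, |(ΔGJ)(x)| ≤ O(1)[(Lʲη)², Lʲη, Lʲη, 1]e^{−δ₃d(y,y′)}|J| (2.136) for x ∈ Δ(y), y ∈ Λ_j,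
supp J ⊂ Δ(y′), with the constant O(1) depending on d and L only"*; p. 247: *"The operator G can be represented as G = G₀(I − R)⁻¹ = Σ_{n≥0} G₀Rⁿ
= Σ_ω h_{□₀}G_{□₀}h_{□₀}K_{□₁}… (2.141), and the series above is convergent in the norms appearing in the inequalities (2.136)–(2.140)"*;
p. 239 [PDF 17]: *"G₀ = Σ_{□∈𝒟} h_□G_□h_□"*, (2.91)–(2.93).

CITATION HEADER (lean-in-tree rule) — WHAT IS REPRODUCED.  Phase-2 file of the `lit-balaban` typed skeleton (HOME `run/shared/lean/pub/lit-balaban/`),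
seat **p38 gen 30** (literature-prover-lit-balaban-p38-g30-0; free target under protocol G.5-34(d), TAKING line HOME/STATUS.md 2026-08-23T13:2xZ, cc the
B6 fold owner r03 and the consumer r05, whose `…B8Prop3MultiLevelTorusP26` takes the (2.136)₂-shape majorants of `∇G(1)` as its «slot 2» with *«no
k-level producer yet»*); SKELETON rows **B6.Prop2.6** × B6.Eq2.133 × B6.Eq2.134 × B6.Eq2.91 (cells only; decls of record untouched).  WHY: for the entry
`|(GJ)(x)|` the tree's k-level chain (`…B6Prop26KLevelSkeletonV2.prop26_2136_kLevel_skeleton₂'` ⇒ r03's `…B6Prop26KLevelAssemblyV1`) runs print's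
Neumann series `G = G₀ΣRⁿ` with the (2.133) bound on the first leg `G₀`; for the entries WITH A LEFT FACTOR `D ∈ {∇_ν, Δ}` print's *"reasoning in the same
way"* is `DG = (DG₀)ΣRⁿ` — the SAME series with the first leg `DG₀ = Σ_□ D(h_□G_□h_□)` bounded through (2.133)₂ (the tree's generic one-box form is
`…B6Prop26ChainGeneric.prop26_entry_of_291With`).  THIS FILE makes that step available at `k` levels WITHOUT re-deriving the (2.134)/(2.135) majorant of `R`:
* §1 (generic, any geometry/lattice): **`hasMajorant_sandwich_in`** — `f·T·h` with an INPUT-localised middle factor (`…B6InMajorantTransplant.InMajorant` on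
  `S`), a left multiplier `|f| ≤ s` supported over `S` and a right one `|h| ≤ 1` supported over `S` has the majorant `1_S(y)1_S(y′)·s·K` (the two-function
  form of `…B6Prop26Gluing.hasMajorant_sandwich`; the shape the product rule `D(h_□G_□h_□) = (h_□∘τ)·(DG_□)·h_□ + (Dh_□)·G_□·h_□` produces);
  **`prop26_pair_of_2133_2134With₂`** — `…B6Prop26KLevelSkeletonV2.prop26_2136_of_2133_2134With₂` (two set families `S ⊆ U`, overlap `N`, (2.133) on `S`,
  (2.134) + output localisation over `U`, (2.91), `GΔ_a = 1`, smallness `N²θ₀c < 1`) with the conclusion STRENGTHENED TO THE PAIR: the `|(GJ)(x)|`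
  majorant `(N·A)c(1 − N²θ₀c)⁻¹·P(y)·e^{−δ₃d}` AND, for EVERY left factor `D`, constant `A′ ≥ 0` and weight `P′ ≥ 0`: if each `D(h_□G_□h_□)` has the
  majorant `1_{U_□}(y)·A′P′(y)e^{−½δ₂d}` then `DG` has the majorant `(N·A′)c(1 − N²θ₀c)⁻¹·P′(y)·e^{−δ₃d}` (same `c`, `θ₀`, `N`, `δ₃ = delta3 α δ₂`);
* §2 (the V1 torus): **`prop26_pair_kLevel_skeleton₂`** / **`prop26_pair_kLevel_skeleton₂'`** — the hypotheses of r03's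
  `prop26_2136_kLevel_skeleton₂` / `…₂'` VERBATIM (same binders, same order), conclusion = r03's (2.136)₁ majorant ∧ the universal left-factor clause on
  `geomT D` / `blkV1 hN D` with the output indicator of `□̃ = SbigT □`: for all `D`, `A′ ≥ 0`, `P′ ≥ 0`,
  `(∀ □, HasMajorant (D * (h_□·G_□·h_□)) (1_{□̃}(y)·A′P′(y)e^{−(δ/(d+1))d_T})) → HasMajorant (D * onFun G) ((Nov·A′)c₁(1 − Nov²θ₀c₁)⁻¹·P′(y)·e^{−δ₃d_T})`.
IMPORTS BY NAME, restating nothing; THEOREMS ONLY (no `def`, no `def … : Prop`, no new hypothesis beyond r03's displayed ones); standard axioms.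

HONEST SCOPE / DIVERGENCES.  (1) This is the GLUING step only: the per-cube left-factor legs (for `D = ∇_ν`: product rule + (2.133)₂ for the genuine
member + the Lipschitz size of `h_□`) and the assembly (r03's `…AssemblyV1` script on this pair skeleton) are the next files of this seat
(`B6GradLegKLevelV1`, `B6Prop26PairKLevelAssemblyV1`, `B6Prop26GradKLevelV1`).  (2) The entry `|(G∇*J)(x)|` (a RIGHT factor) and the Hölder entries
(2.137)–(2.140) are not touched.  (3) As in the imported skeleton: integer torus, lattice units (`η = 1` in `geomT`, the physical `Lʲη` is carried by the
weight `P′`), `L ≥ 2`, `M_h ≥ 2`, `R ≥ 2L`, `P′_μ ≥ 5`; nothing on d = 4 specifically or the continuum; NOT summit progress.  Unit `lit-balaban-p38`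
(gen 30), 2026-08-23.
-/

open scoped BigOperators
open Finset

namespace Literature.MathematicalPhysics.QuantumFieldTheory.Balaban1983to89.B6Prop26LeftEntryKLevelV1

open B4Reflection242 (boxDom)
open B6MultiLevelBoxOperator (N0)
open B6MultiLevelTorusOperator (TDomains)
open B6Cover236MultiLevelBlocks (cubes)
open B6Geom246MultiLevelBox (bset blkOf)
open B6Geom246MultiLevelTorus (geomT lemma21_torus triangle_refl_nonneg_T)
open B6RandomWalk (HasMajorant hasMajorant_mono delta3 Triangle254 BlockSupp)
open B6Prop26Gluing (mulOp mulOp_apply LocalMajorant OutLoc majorant_G0_of_2133 ineq2135_of_2134_291 ind ind_nonneg ind_le_one ind_of_mem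
  ind_of_not_mem hasMajorant_sum_overlap mulOp_eq_zero_of_blockSupp blockSupp_mulOp)
open B6Prop26 (fixedPoint_of_291)
open B6Lemma21Repaired (Ineq261With Ineq263With)
open B6Ineq261LevelGap (K261 K261_nonneg)
open B6Prop26ChainGeneric (prop26_chain_2136With prop26_entry_of_291With)
open B6Eq291Generator (kFam kDiag kOff gZero rOp eq291)
open B6Ineq2133TwoScaleV1 (onFun)
open B6GlobalChartV1 (PV toBox domT blkV1)
open B6AgreeLapV1Chart (deltaAE_split onFun_comp onFun_id)
open B6SectAOperatorsV1 (dE dsE dcE dcsE QE aE QsE RE BondIdx)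
open B6SectAVectorModelV1 (deltaAE GE GE_comp_deltaAE)
open B6Partition118KLevelTorusCentral (QT QbigT zetaT QT_subset_QbigT one_le_of_four_le)
open B6Prop26KLevelSkeletonV1 (hB zB ST mem_ST pref pref_nonneg sum_hB_sq abs_hB_le_one blkV1_mem_QT_of_hB_ne_zero mulOp_zB_mul_hB mulOp_hB_mul_zB
  sum_mulOp_hB_sq onFun_GE_mul_deltaAE)
open B6Prop26KLevelSkeletonV2 (SbigT mem_SbigT ST_subset_SbigT hNov_SbigT_of_QbigT outLoc_kFam_big prop26_2136_of_2133_2134With₂)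
open B6InMajorantTransplant (InMajorant)

noncomputable section

/-! ## §1  Generic: the two-function sandwich with an input-localised middle factor; the left-entry gluing -/

section Generic

variable {g : B6.Geometry} {X : Type}

/-- **THE SANDWICH `f·T·h` WITH AN INPUT-LOCALISED MIDDLE FACTOR** (the shape of the two terms of `∇(h_□G_□h_□) = (h_□∘τ)·(∇G_□)·h_□ + (∇h_□)·G_□·h_□`,
print's first leg of (2.141) for the entry `|(∇GJ)(x)|`): `T` with an input-localised majorant `K ≥ 0` over `S` (outputs anywhere), `|f| ≤ s` supported
over the blocks of `S`, `|h| ≤ 1` supported over the blocks of `S` ⟹ `f·T·h` has the majorant `1_S(y)·1_S(y′)·s·K(y,y′)`.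
[cite: Balaban1984PropagatorsII, (2.141) p.247 (first leg), (2.90)–(2.91) p.239, (2.133) p.247] -/
theorem hasMajorant_sandwich_in (blk : X → g.Site) {T : Module.End ℝ (X → ℝ)} {f h : X → ℝ} {S : Set g.Site}
    {K : g.Site → g.Site → ℝ} {s : ℝ} (hK : ∀ a b, 0 ≤ K a b) (hs : 0 ≤ s)
    (hfsupp : ∀ x, f x ≠ 0 → blk x ∈ S) (hfle : ∀ x, |f x| ≤ s)
    (hhsupp : ∀ x, h x ≠ 0 → blk x ∈ S) (hhle : ∀ x, |h x| ≤ 1) (hT : InMajorant blk T S K) :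
    HasMajorant blk (mulOp f * T * mulOp h) (fun a b => ind S a * ind S b * (s * K a b)) := by
  intro y' μ B hμ x
  beta_reduce
  have hnn : 0 ≤ ind S (blk x) * ind S y' * (s * K (blk x) y') * B :=
    mul_nonneg (mul_nonneg (mul_nonneg (ind_nonneg _ _) (ind_nonneg _ _)) (mul_nonneg hs (hK _ _))) hμ.nonneg
  rw [Module.End.mul_apply, Module.End.mul_apply, mulOp_apply]
  by_cases hx : f x = 0
  · rw [hx, zero_mul, abs_zero]
    exact hnn
  have hxS : blk x ∈ S := hfsupp x hx
  by_cases hy : y' ∈ S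
  · rw [ind_of_mem hxS, ind_of_mem hy, one_mul, one_mul, abs_mul]
    calc |f x| * |T (mulOp h μ) x| ≤ s * (K (blk x) y' * B) :=
          mul_le_mul (hfle x) (hT y' hy (mulOp h μ) B (blockSupp_mulOp blk hhle hμ) x) (abs_nonneg _) hs
      _ = s * K (blk x) y' * B := by ring
  · rw [mulOp_eq_zero_of_blockSupp blk hhsupp hμ hy, map_zero, Pi.zero_apply, mul_zero, abs_zero]
    exact hnn

/-- the output indicator may be enlarged. [cite: Balaban1984PropagatorsII, p.235, bookkeeping] -/
theorem ind_mono {S U : Set g.Site} (hSU : S ⊆ U) (a : g.Site) : ind S a ≤ ind U a := by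
  by_cases ha : a ∈ S
  · rw [ind_of_mem ha, ind_of_mem (hSU ha)]
  · rw [ind_of_not_mem ha]; exact ind_nonneg _ _

/-- dropping the input indicator and enlarging the output one: `1_S(y)1_S(y′)K ≤ 1_U(y)K` for `S ⊆ U`, `K ≥ 0`.
[cite: Balaban1984PropagatorsII, p.235, bookkeeping] -/
theorem ind_ind_le_ind {S U : Set g.Site} (hSU : S ⊆ U) {K : g.Site → g.Site → ℝ} (hK : ∀ a b, 0 ≤ K a b) (a b : g.Site) :
    ind S a * ind S b * K a b ≤ ind U a * K a b :=
  calc ind S a * ind S b * K a b ≤ ind S a * 1 * K a b :=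
        mul_le_mul_of_nonneg_right (mul_le_mul_of_nonneg_left (ind_le_one _ _) (ind_nonneg _ _)) (hK a b)
    _ ≤ ind U a * K a b := by rw [mul_one]; exact mul_le_mul_of_nonneg_right (ind_mono hSU a) (hK a b)

open Classical in
/-- **PROP. 2.6 — THE ENTRY `|(GJ)(x)|` AND EVERY LEFT-FACTOR ENTRY AT ONCE, FROM THE PER-BOX INPUTS, TWO SET FAMILIES**
(`…B6Prop26KLevelSkeletonV2.prop26_2136_of_2133_2134With₂` with the conclusion strengthened to the pair).  Data as there: boxes `𝒟`, sets `S_□ ⊆ U_□`,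
`U_□` of overlap `N`, `|h_□| ≤ 1` supported over `S_□`, (2.133) for `G_□` on `S_□`, (2.134) for `K_{□,□′}G_{□′}h_{□′}` with output localisation over `U_□`,
`G₀ = Σ h_□G_□h_□`, `R = Σ K_{□,□′}G_{□′}h_{□′}`, (2.91) `Δ_aG₀ = 1 − R`, `GΔ_a = 1`, `N²θ₀c < 1`.  THEN (i) `G` has the majorant
`(N·A)c(1 − N²θ₀c)⁻¹·P(y)·e^{−δ₃d}`; (ii) for every left factor `D`, `A′ ≥ 0`, `P′ ≥ 0` with `D(h_□G_□h_□)` majorised by `1_{U_□}(y)·A′P′(y)e^{−½δ₂d}`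
for every box, `DG` has the majorant `(N·A′)c(1 − N²θ₀c)⁻¹·P′(y)·e^{−δ₃d}` — print's «reasoning in the same way as in the proof of Proposition 2.2»
for the table `[(Lʲη)², Lʲη, ·, 1]`: the series `DG = (DG₀)ΣRⁿ` ((2.141)), first leg through (2.133), the other legs through (2.135).
[cite: Balaban1984PropagatorsII, Prop. 2.6 (2.136) p.247, (2.141) p.247, (2.133)–(2.135) p.247, (2.91)–(2.93) p.239] -/
theorem prop26_pair_of_2133_2134With₂ [Fintype X] [DecidableEq X] (blk : X → g.Site) (c δ₂ α θ₀ A : ℝ)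
    (P : g.Site → ℝ) (hc : 0 ≤ c) (hA : 0 ≤ A) (hP : ∀ y, 0 ≤ P y) (hθ₀ : 0 ≤ θ₀) (hα : α ≤ 1) (hδ₂ : 0 ≤ δ₂)
    (htri : Triangle254 g) (hrefl : ∀ y : g.Site, g.dist y y = 0) (hdnn : ∀ y y' : g.Site, 0 ≤ g.dist y y')
    (h261 : Ineq261With c g (δ₂ / 2) α) (h263 : Ineq263With c g (δ₂ / 2) α)
    {C : Type} (D : Finset C) (S U : C → Set g.Site) (hSU : ∀ i ∈ D, S i ⊆ U i) (N : ℕ)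
    (hN : ∀ a : g.Site, (D.filter fun i => a ∈ U i).card ≤ N)
    (hsmall : (N : ℝ) ^ 2 * θ₀ * c < 1)
    (h : C → X → ℝ) (hsupp : ∀ i ∈ D, ∀ x, h i x ≠ 0 → blk x ∈ S i) (hle : ∀ i ∈ D, ∀ x, |h i x| ≤ 1)
    (Gl : C → Module.End ℝ (X → ℝ))
    (h2133 : ∀ i ∈ D,
      LocalMajorant blk (Gl i) (S i) (fun a b => A * P a * Real.exp (-(δ₂ / 2 * g.dist a b))))
    (Kt : C → C → Module.End ℝ (X → ℝ))
    (h2134 : ∀ i ∈ D, ∀ i' ∈ D,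
      HasMajorant blk (Kt i i' * mulOp (h i')) (fun a b => θ₀ * Real.exp (-(δ₂ / 2 * g.dist a b))))
    (hKout : ∀ i ∈ D, ∀ i' ∈ D, OutLoc blk (Kt i i') (U i))
    {G G0 R Δa : Module.End ℝ (X → ℝ)}
    (hG0 : G0 = ∑ i ∈ D, mulOp (h i) * Gl i * mulOp (h i))
    (hR : R = ∑ i ∈ D, ∑ i' ∈ D, Kt i i' * mulOp (h i'))
    (hinv : G * Δa = 1) (h291 : Δa * G0 = 1 - R) :
    HasMajorant blk G (fun a b => (N * A) * c * (1 - (N : ℝ) ^ 2 * θ₀ * c)⁻¹ * P a *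
      Real.exp (-(delta3 α δ₂ * g.dist a b))) ∧
    ∀ (Dop : Module.End ℝ (X → ℝ)) (A' : ℝ) (P' : g.Site → ℝ), 0 ≤ A' → (∀ y, 0 ≤ P' y) →
      (∀ i ∈ D, HasMajorant blk (Dop * (mulOp (h i) * Gl i * mulOp (h i)))
        (fun a b => ind (U i) a * (A' * P' a * Real.exp (-(δ₂ / 2 * g.dist a b))))) →
      HasMajorant blk (Dop * G) (fun a b => (N * A') * c * (1 - (N : ℝ) ^ 2 * θ₀ * c)⁻¹ * P' a *
        Real.exp (-(delta3 α δ₂ * g.dist a b))) := by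
  have hfirst := prop26_2136_of_2133_2134With₂ blk c δ₂ α θ₀ A P hc hA hP hθ₀ hα hδ₂ htri hrefl hdnn h261 h263 D S U hSU N hN hsmall h
    hsupp hle Gl h2133 Kt h2134 hKout hG0 hR hinv h291
  refine ⟨hfirst, fun Dop A' P' hA' hP' hD => ?_⟩
  have hsuppU : ∀ i ∈ D, ∀ x, h i x ≠ 0 → blk x ∈ U i := fun i hi x hx => hSU i hi (hsupp i hi x hx)
  have hRm : HasMajorant blk R (fun a b => (N : ℝ) ^ 2 * θ₀ * Real.exp (-(δ₂ / 2 * g.dist a b))) :=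
    ineq2135_of_2134_291 blk D U N hN h hsuppU Kt δ₂ θ₀ hθ₀ h2134 hKout hR
  have hK' : ∀ a b, 0 ≤ A' * P' a * Real.exp (-(δ₂ / 2 * g.dist a b)) := fun a b =>
    mul_nonneg (mul_nonneg hA' (hP' a)) (Real.exp_nonneg _)
  have hDG0 : HasMajorant blk (Dop * G0) (fun a b => N * A' * P' a * Real.exp (-(δ₂ / 2 * g.dist a b))) := by
    rw [hG0, Finset.mul_sum]
    refine hasMajorant_mono blk (hasMajorant_sum_overlap blk D U _ _ hK' hD N hN) fun a b => le_of_eq ?_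
    ring
  have hαδ : 0 ≤ (1 - α) * (δ₂ / 2) := mul_nonneg (by linarith) (by linarith)
  have hh := prop26_entry_of_291With blk c (δ₂ / 2) α ((N : ℝ) ^ 2 * θ₀) (N * A') P' hc (mul_nonneg (Nat.cast_nonneg N) hA') hP'
    (mul_nonneg (sq_nonneg _) hθ₀) hαδ htri hrefl hdnn h261 h263 hsmall Dop hinv h291 hDG0 hRm
  refine hasMajorant_mono blk hh fun a b => le_of_eq ?_
  show _ = _
  unfold delta3
  ring_nf

end Generic

/-! ## §2  The k-level «pair» skeleton on the V1 torus: r03's two-family skeleton with the universal left-factor clause -/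

section Skeleton

variable {d ℓ : ℕ} {hd : 1 ≤ d + 1} {hL : Odd (ℓ + 1) ∧ 1 < ℓ + 1} {m K : ℕ} {Mh k R : ℕ} {P' : Fin (d + 1) → ℕ}

open Classical in
/-- **THE k-LEVEL PAIR SKELETON (two set families)**: the hypotheses of `…B6Prop26KLevelSkeletonV2.prop26_2136_kLevel_skeleton₂` VERBATIM; conclusion =
its (2.136)₁ majorant of `onFun G` ∧ the universal left-factor clause: for every left factor `D`, `A′ ≥ 0`, `P′ ≥ 0`, if every `D(h_□G_□h_□)` is
majorised by `1_{□̃}(y)·A′P′(y)e^{−(δ/(d+1))d_T}` then `D·(onFun G)` is majorised by `(Nov·A′)c₁(1 − Nov²θ₀c₁)⁻¹·P′(y)·e^{−δ₃d_T}`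
(`c₁ = K261 N₀ (d+1) L 1 (αδ/(d+1))`, `δ₃ = delta3 α (2δ/(d+1))`).
[cite: Balaban1984PropagatorsII, Prop. 2.6 (2.136) p.247, (2.141) p.247, (2.133)–(2.135) p.247, (2.91)–(2.93) p.239, (2.36) p.229, Lemma 2.1 p.234] -/
theorem prop26_pair_kLevel_skeleton₂ (hN : ∀ μ, N0 ℓ Mh k P' μ = (PV d ℓ m K hd hL).sitesPerDir 0) (D : TDomains d ℓ Mh k P' R) (hk : k ≤ m + K)
    (hMh : 2 ≤ Mh) (hR : 2 * (ℓ + 1) ≤ R) (hP5 : ∀ μ, 5 ≤ P' μ)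
    {δ A : ℝ} (hδ : 0 < δ) (hA : 0 ≤ A)
    (α : ℝ) (hα0 : 0 ≤ α) (hα1 : α ≤ 1) (N₀ : ℕ) (hN₀ : 0 < N₀) (hRM : N₀ + 1 ≤ R * ((ℓ + 1) * Mh))
    (hθ : Real.exp (-(α * (δ / (d + 1)))) * ((ℓ : ℝ) + 1) ^ ((2 * (d + 1 : ℕ) : ℝ) / N₀) < 1)
    {cf : ℝ} (hcf : cf ≠ 0) {w : BondIdx (domT hN D hk) → ℝ} (hw : ∀ i, 0 < w i)
    (Nov : ℕ) (hNov : ∀ a : (geomT D).Site, (Finset.univ.filter fun c : ↥(cubes D.toDomains) =>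
      a ∈ SbigT D (le_trans one_le_two hMh) (fun μ => le_trans (by norm_num) (hP5 μ)) c).card ≤ Nov)
    (Gl Ml Pl : ↥(cubes D.toDomains) → Module.End ℝ (PBond (PV d ℓ m K hd hL) 0 → ℝ))
    (h2133 : ∀ c, LocalMajorant (g := geomT D) (blkV1 hN D) (Gl c)
      (ST D (le_trans one_le_two hMh) (fun μ => le_trans (by norm_num) (hP5 μ)) c)
      (fun a b => A * pref cf a * Real.exp (-((2 * (δ / (d + 1))) / 2 * (geomT D).dist a b))))
    (hagree : ∀ c, onFun (dcsE (P := PV d ℓ m K hd hL) cf ∘ₗ dcE cf + dE cf ∘ₗ dsE cf +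
        QsE (domT hN D hk) ∘ₗ aE (domT hN D hk) w ∘ₗ QE (domT hN D hk)) * mulOp (hB hN D c) = Ml c * mulOp (hB hN D c))
    (hinvl : ∀ c, (Ml c - Pl c) * Gl c * mulOp (hB hN D c) = mulOp (hB hN D c))
    (θ₀ : ℝ) (hθ₀ : 0 ≤ θ₀)
    (h2134 : ∀ c c', HasMajorant (g := geomT D) (blkV1 hN D)
      ((kFam (onFun (dE (P := PV d ℓ m K hd hL) cf ∘ₗ (LinearMap.id - RE (domT hN D hk) cf) ∘ₗ dsE cf))
          (fun c => mulOp (hB hN D c)) (fun c => mulOp (zB hN D (le_trans one_le_two hMh) (fun μ => le_trans (by norm_num) (hP5 μ)) c))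
          Ml Pl c c' * Gl c') * mulOp (hB hN D c'))
      (fun a b => θ₀ * Real.exp (-((2 * (δ / (d + 1))) / 2 * (geomT D).dist a b))))
    (hKout : ∀ c c', OutLoc (g := geomT D) (blkV1 hN D)
      (kFam (onFun (dE (P := PV d ℓ m K hd hL) cf ∘ₗ (LinearMap.id - RE (domT hN D hk) cf) ∘ₗ dsE cf))
          (fun c => mulOp (hB hN D c)) (fun c => mulOp (zB hN D (le_trans one_le_two hMh) (fun μ => le_trans (by norm_num) (hP5 μ)) c))
          Ml Pl c c' * Gl c')
      (SbigT D (le_trans one_le_two hMh) (fun μ => le_trans (by norm_num) (hP5 μ)) c))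
    (hsmall : (Nov : ℝ) ^ 2 * θ₀ * K261 N₀ (d + 1) ((ℓ : ℝ) + 1) 1 (α * (δ / (d + 1))) < 1) :
    HasMajorant (g := geomT D) (blkV1 hN D) (onFun (GE (domT hN D hk) hcf hw))
      (fun a b => (Nov * A) * K261 N₀ (d + 1) ((ℓ : ℝ) + 1) 1 (α * (δ / (d + 1))) *
        (1 - (Nov : ℝ) ^ 2 * θ₀ * K261 N₀ (d + 1) ((ℓ : ℝ) + 1) 1 (α * (δ / (d + 1))))⁻¹ * pref cf a *
        Real.exp (-(delta3 α (2 * (δ / (d + 1))) * (geomT D).dist a b))) ∧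
    ∀ (Dop : Module.End ℝ (PBond (PV d ℓ m K hd hL) 0 → ℝ)) (A' : ℝ) (Pw : (geomT D).Site → ℝ), 0 ≤ A' → (∀ y, 0 ≤ Pw y) →
      (∀ c, HasMajorant (g := geomT D) (blkV1 hN D) (Dop * (mulOp (hB hN D c) * Gl c * mulOp (hB hN D c)))
        (fun a b => ind (SbigT D (le_trans one_le_two hMh) (fun μ => le_trans (by norm_num) (hP5 μ)) c) a *
          (A' * Pw a * Real.exp (-((2 * (δ / (d + 1))) / 2 * (geomT D).dist a b))))) →
      HasMajorant (g := geomT D) (blkV1 hN D) (Dop * onFun (GE (domT hN D hk) hcf hw))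
        (fun a b => (Nov * A') * K261 N₀ (d + 1) ((ℓ : ℝ) + 1) 1 (α * (δ / (d + 1))) *
          (1 - (Nov : ℝ) ^ 2 * θ₀ * K261 N₀ (d + 1) ((ℓ : ℝ) + 1) 1 (α * (δ / (d + 1))))⁻¹ * Pw a *
          Real.exp (-(delta3 α (2 * (δ / (d + 1))) * (geomT D).dist a b))) := by
  classical
  have hMh1 : 1 ≤ Mh := le_trans one_le_two hMh
  have hP4 : ∀ μ, 4 ≤ P' μ := fun μ => le_trans (by norm_num) (hP5 μ)
  have hP : ∀ μ, 1 ≤ P' μ := one_le_of_four_le hP4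
  have hδ0 : (0 : ℝ) ≤ δ / (d + 1) := by positivity
  obtain ⟨_, h261, _, h263⟩ := lemma21_torus D hMh1 hP hN₀ hRM hδ0 hα0 hα1 hθ
  obtain ⟨htri, hrefl, hdnn⟩ := triangle_refl_nonneg_T D hMh1 hP
  have hc : 0 ≤ K261 N₀ (d + 1) ((ℓ : ℝ) + 1) 1 (α * (δ / (d + 1))) := K261_nonneg (by positivity) zero_le_one
  have hδ2 : (0 : ℝ) ≤ 2 * (δ / (d + 1)) := by positivity
  have hhalf : 2 * (δ / (d + 1)) / 2 = δ / (d + 1) := by ring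
  have hle : ∀ c ∈ (Finset.univ : Finset ↥(cubes D.toDomains)), ∀ b, |hB hN D c b| ≤ 1 := fun c _ b => abs_hB_le_one hN D hMh1 hP c b
  have hsupp : ∀ c ∈ (Finset.univ : Finset ↥(cubes D.toDomains)), ∀ b, hB hN D c b ≠ 0 →
      blkV1 hN D b ∈ ST D hMh1 hP4 c := fun c _ b hb => blkV1_mem_QT_of_hB_ne_zero hN D hMh hR hP4 c hb
  have h291 : onFun (deltaAE (domT hN D hk) cf w) * gZero Finset.univ (fun c => mulOp (hB hN D c)) Gl =
      1 - rOp Finset.univ (onFun (dE (P := PV d ℓ m K hd hL) cf ∘ₗ (LinearMap.id - RE (domT hN D hk) cf) ∘ₗ dsE cf))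
        (fun c => mulOp (hB hN D c)) (fun c => mulOp (zB hN D hMh1 hP4 c)) Gl Ml Pl := by
    rw [deltaAE_split]
    exact eq291 Finset.univ _ _ (fun c => mulOp (hB hN D c)) (fun c => mulOp (zB hN D hMh1 hP4 c)) Gl Ml Pl
      (sum_mulOp_hB_sq hN D hMh1 hP) (fun c _ => hagree c) (fun c _ => hinvl c)
      (fun c _ => mulOp_zB_mul_hB hN D hMh hR hP4 c) (fun c _ => mulOp_hB_mul_zB hN D hMh hR hP4 c)
  have hinv := onFun_GE_mul_deltaAE (domT hN D hk) hcf hw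
  have hmain := prop26_pair_of_2133_2134With₂ (g := geomT D) (blkV1 hN D) (K261 N₀ (d + 1) ((ℓ : ℝ) + 1) 1 (α * (δ / (d + 1))))
    (2 * (δ / (d + 1))) α θ₀ A (pref cf) hc hA (pref_nonneg cf) hθ₀ hα1 hδ2 htri hrefl hdnn (by rw [hhalf]; exact h261) (by rw [hhalf]; exact h263)
    Finset.univ (fun c => ST D hMh1 hP4 c) (fun c => SbigT D hMh1 hP4 c) (fun c _ => ST_subset_SbigT D hMh1 hP4 c)
    Nov hNov hsmall (hB hN D) hsupp hle Gl (fun c _ => h2133 c)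
    (fun c c' => kFam (onFun (dE (P := PV d ℓ m K hd hL) cf ∘ₗ (LinearMap.id - RE (domT hN D hk) cf) ∘ₗ dsE cf))
      (fun c => mulOp (hB hN D c)) (fun c => mulOp (zB hN D hMh1 hP4 c)) Ml Pl c c' * Gl c')
    (fun c _ c' _ => h2134 c c') (fun c _ c' _ => hKout c c') (G0 := gZero Finset.univ (fun c => mulOp (hB hN D c)) Gl)
    (R := rOp Finset.univ (onFun (dE (P := PV d ℓ m K hd hL) cf ∘ₗ (LinearMap.id - RE (domT hN D hk) cf) ∘ₗ dsE cf))
      (fun c => mulOp (hB hN D c)) (fun c => mulOp (zB hN D hMh1 hP4 c)) Gl Ml Pl) rfl rfl hinv h291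
  exact ⟨hmain.1, fun Dop A' Pw hA' hPw hD => hmain.2 Dop A' Pw hA' hPw (fun c _ => hD c)⟩

open Classical in
/-- **THE k-LEVEL PAIR SKELETON WITH (hKout) DISCHARGED** from `hMout : OutLoc (M_□·h_□) □̃` (`…SkeletonV2.outLoc_kFam_big`) — the hypotheses of r03's
`prop26_2136_kLevel_skeleton₂'` VERBATIM, conclusion = its (2.136)₁ majorant ∧ the universal left-factor clause.
[cite: Balaban1984PropagatorsII, Prop. 2.6 (2.136) p.247, (2.141) p.247, (2.91)–(2.93) p.239, (2.133)–(2.135) p.247] -/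
theorem prop26_pair_kLevel_skeleton₂' (hN : ∀ μ, N0 ℓ Mh k P' μ = (PV d ℓ m K hd hL).sitesPerDir 0) (D : TDomains d ℓ Mh k P' R) (hk : k ≤ m + K)
    (hMh : 2 ≤ Mh) (hR : 2 * (ℓ + 1) ≤ R) (hP5 : ∀ μ, 5 ≤ P' μ)
    {δ A : ℝ} (hδ : 0 < δ) (hA : 0 ≤ A)
    (α : ℝ) (hα0 : 0 ≤ α) (hα1 : α ≤ 1) (N₀ : ℕ) (hN₀ : 0 < N₀) (hRM : N₀ + 1 ≤ R * ((ℓ + 1) * Mh))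
    (hθ : Real.exp (-(α * (δ / (d + 1)))) * ((ℓ : ℝ) + 1) ^ ((2 * (d + 1 : ℕ) : ℝ) / N₀) < 1)
    {cf : ℝ} (hcf : cf ≠ 0) {w : BondIdx (domT hN D hk) → ℝ} (hw : ∀ i, 0 < w i)
    (Nov : ℕ) (hNov : ∀ a : (geomT D).Site, (Finset.univ.filter fun c : ↥(cubes D.toDomains) =>
      a ∈ SbigT D (le_trans one_le_two hMh) (fun μ => le_trans (by norm_num) (hP5 μ)) c).card ≤ Nov)
    (Gl Ml Pl : ↥(cubes D.toDomains) → Module.End ℝ (PBond (PV d ℓ m K hd hL) 0 → ℝ))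
    (h2133 : ∀ c, LocalMajorant (g := geomT D) (blkV1 hN D) (Gl c)
      (ST D (le_trans one_le_two hMh) (fun μ => le_trans (by norm_num) (hP5 μ)) c)
      (fun a b => A * pref cf a * Real.exp (-((2 * (δ / (d + 1))) / 2 * (geomT D).dist a b))))
    (hagree : ∀ c, onFun (dcsE (P := PV d ℓ m K hd hL) cf ∘ₗ dcE cf + dE cf ∘ₗ dsE cf +
        QsE (domT hN D hk) ∘ₗ aE (domT hN D hk) w ∘ₗ QE (domT hN D hk)) * mulOp (hB hN D c) = Ml c * mulOp (hB hN D c))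
    (hinvl : ∀ c, (Ml c - Pl c) * Gl c * mulOp (hB hN D c) = mulOp (hB hN D c))
    (hMout : ∀ c, OutLoc (g := geomT D) (blkV1 hN D) (Ml c * mulOp (hB hN D c))
      (SbigT D (le_trans one_le_two hMh) (fun μ => le_trans (by norm_num) (hP5 μ)) c))
    (θ₀ : ℝ) (hθ₀ : 0 ≤ θ₀)
    (h2134 : ∀ c c', HasMajorant (g := geomT D) (blkV1 hN D)
      ((kFam (onFun (dE (P := PV d ℓ m K hd hL) cf ∘ₗ (LinearMap.id - RE (domT hN D hk) cf) ∘ₗ dsE cf))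
          (fun c => mulOp (hB hN D c)) (fun c => mulOp (zB hN D (le_trans one_le_two hMh) (fun μ => le_trans (by norm_num) (hP5 μ)) c))
          Ml Pl c c' * Gl c') * mulOp (hB hN D c'))
      (fun a b => θ₀ * Real.exp (-((2 * (δ / (d + 1))) / 2 * (geomT D).dist a b))))
    (hsmall : (Nov : ℝ) ^ 2 * θ₀ * K261 N₀ (d + 1) ((ℓ : ℝ) + 1) 1 (α * (δ / (d + 1))) < 1) :
    HasMajorant (g := geomT D) (blkV1 hN D) (onFun (GE (domT hN D hk) hcf hw))
      (fun a b => (Nov * A) * K261 N₀ (d + 1) ((ℓ : ℝ) + 1) 1 (α * (δ / (d + 1))) *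
        (1 - (Nov : ℝ) ^ 2 * θ₀ * K261 N₀ (d + 1) ((ℓ : ℝ) + 1) 1 (α * (δ / (d + 1))))⁻¹ * pref cf a *
        Real.exp (-(delta3 α (2 * (δ / (d + 1))) * (geomT D).dist a b))) ∧
    ∀ (Dop : Module.End ℝ (PBond (PV d ℓ m K hd hL) 0 → ℝ)) (A' : ℝ) (Pw : (geomT D).Site → ℝ), 0 ≤ A' → (∀ y, 0 ≤ Pw y) →
      (∀ c, HasMajorant (g := geomT D) (blkV1 hN D) (Dop * (mulOp (hB hN D c) * Gl c * mulOp (hB hN D c)))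
        (fun a b => ind (SbigT D (le_trans one_le_two hMh) (fun μ => le_trans (by norm_num) (hP5 μ)) c) a *
          (A' * Pw a * Real.exp (-((2 * (δ / (d + 1))) / 2 * (geomT D).dist a b))))) →
      HasMajorant (g := geomT D) (blkV1 hN D) (Dop * onFun (GE (domT hN D hk) hcf hw))
        (fun a b => (Nov * A') * K261 N₀ (d + 1) ((ℓ : ℝ) + 1) 1 (α * (δ / (d + 1))) *
          (1 - (Nov : ℝ) ^ 2 * θ₀ * K261 N₀ (d + 1) ((ℓ : ℝ) + 1) 1 (α * (δ / (d + 1))))⁻¹ * Pw a *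
          Real.exp (-(delta3 α (2 * (δ / (d + 1))) * (geomT D).dist a b))) :=
  prop26_pair_kLevel_skeleton₂ hN D hk hMh hR hP5 hδ hA α hα0 hα1 N₀ hN₀ hRM hθ hcf hw Nov hNov Gl Ml Pl h2133 hagree hinvl θ₀ hθ₀ h2134
    (outLoc_kFam_big hN D hMh hR (le_trans one_le_two hMh) (fun μ => le_trans (by norm_num) (hP5 μ)) _ Gl Ml Pl hMout) hsmall

end Skeleton

end

end Literature.MathematicalPhysics.QuantumFieldTheory.Balaban1983to89.B6Prop26LeftEntryKLevelV1
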